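import Summits.RiemannHypothesis.RiemannHypothesis.Theorems.WeilParityEvenWinsBeyondArchFrontierLog5HalfOfBlocks
import Summits.RiemannHypothesis.RiemannHypothesis.Theorems.GroundBartaEvenWinsBeyondArchDeflationFourPrimeWindow
import HarnessLib

/-!
# RiemannHypothesis / GroundBarta — rung 4: CELL 7 `[(log 5)/2, 83/100]` of the parity ladder (first window with the prime `5`
# visible) and Weil positivity on `[-83/100, 83/100]`, from the two sector blocks at `83/100`

Helper file (`--supports stmt-RiemannHypothesis-18085`), RH-free, pure logic (prover A g11; the cell template of
`…FrontierLog5HalfOfBlocks`).  Beyond the three-prime endpoint `(log 5)/2` the prime power `5` enters the window; the design of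
the blocks at `c₁ = 83/100` (two-prime certificate on the extended minorant chain `[0, 224]` at the sharp level `21/8`, edge slivers
of `4` and `5`, three-zone deflated Temple criterion `…CertBridgeWXA45`) is `DESIGN-BEYOND-LOG5HALF.md` of unit `sr-gb-rung-a`.  This file
states what the two blocks deliver, as implications from their conclusions:

* `weilWindowSimpleEven_on_cell7_of_oddLower` — with the landed sharp U-side `trialUpper80sharp : ε(4023/5000) ≤ 10⁻¹⁷` (monotone to
  `(log 5)/2`), ONE odd lower bound `10⁻¹⁷ < L ≤ ε_od(83/100)` gives `WeilWindowSimpleEven a` on the whole cell `[4023/5000, 83/100]` ⊇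
  `[(log 5)/2, 83/100]`;
* `weilWindowSimpleEven_upTo_83_of_oddLower` — hence on `(0, 83/100]` (with `weilWindowSimpleEven_upTo_M80`), and the tail shape;
* `weilPositivityOn_83_of_blocks` — `0 ≤ ε_ev(83/100)` and `0 ≤ ε_od(83/100)` give `WeilPositivityOn (83/100)` (`dt_weilPositivityOn`):
  Weil positivity for every test function supported in `[-0.83, 0.83]` (`e^{1.66} = 5.26`: prime powers `2, 3, 4, 5` visible), and every
  smaller window.
-/

set_option linter.dupNamespace false

noncomputable section

open Set MeasureTheory

namespace Summit.RiemannHypothesis.RiemannHypothesis.Theorems.EvenWinsBeyondArch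

open Literature.NumberTheory.LFunctions

/-- `(log 5)/2 < 83/100` (the cell reaches past the three-prime endpoint; `log 5 ≤ 1.60943791243410037460008`). [folklore] -/
theorem log5half_lt_83 : Real.log 5 / 2 < (83 / 100 : ℝ) := by
  have h := dt_fp_log5_bracket.2
  norm_num at h ⊢
  linarith

/-- **Cell 7 `[4023/5000, 83/100]`** (⊇ `[(log 5)/2, 83/100]`): `10⁻¹⁷ < L ≤ ε_od(83/100) ⟹ WeilWindowSimpleEven a` for
`a ∈ [4023/5000, 83/100]`. [folklore] -/
theorem weilWindowSimpleEven_on_cell7_of_oddLower {L : ℝ} (hUL : (1 / 100000000000000000 : ℝ) < L)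
    (hL : L ≤ weilOddGroundEnergy (83 / 100)) {a : ℝ} (hlo : (4023 / 5000 : ℝ) ≤ a) (hhi : a ≤ 83 / 100) :
    WeilWindowSimpleEven a :=
  GroundStateSimpleEven.weilWindowSimpleEven_on_cell_of_le (b := (4023 / 5000 : ℝ)) (c := (83 / 100 : ℝ)) (by norm_num) hUL
    trialUpper80sharp (fun _ hg hs hn ho ↦ hL.trans (weilOddGroundEnergy_le hg hs ho hn)) hlo hhi

/-- **`WeilWindowSimpleEven` on `(0, 83/100]`** from the landed ladder up to `4023/5000` and one odd-sector lower bound at `83/100`.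
[folklore] -/
theorem weilWindowSimpleEven_upTo_83_of_oddLower {L : ℝ} (hUL : (1 / 100000000000000000 : ℝ) < L)
    (hL : L ≤ weilOddGroundEnergy (83 / 100)) :
    ∀ a : ℝ, 0 < a → a ≤ 83 / 100 → WeilWindowSimpleEven a := by
  intro a ha hle
  rcases le_or_gt a (4023 / 5000) with h | h
  · exact weilWindowSimpleEven_upTo_M80 a ha h
  · exact weilWindowSimpleEven_on_cell7_of_oddLower hUL hL h.le hle

/-- Tail shape of item 18085 up to `83/100`, from the odd block at `83/100`. [folklore] -/
theorem tailSimpleEven_upTo_83_of_oddLower {L : ℝ} (hUL : (1 / 100000000000000000 : ℝ) < L)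
    (hL : L ≤ weilOddGroundEnergy (83 / 100)) :
    ∀ a : ℝ, Real.log 2 < a → a ≤ 83 / 100 → WeilWindowSimpleEven a :=
  fun a ha hle ↦ weilWindowSimpleEven_upTo_83_of_oddLower hUL hL a ((Real.log_pos (by norm_num)).trans ha) hle

/-- **Weil positivity on `[-83/100, 83/100]` from the two blocks**: `0 ≤ ε_ev(83/100)` and `0 ≤ ε_od(83/100)` give
`WeilPositivityOn (83/100)`. [folklore] -/
theorem weilPositivityOn_83_of_blocks (hE : 0 ≤ weilEvenGroundEnergy (83 / 100))
    (hO : 0 ≤ weilOddGroundEnergy (83 / 100)) : WeilPositivityOn (83 / 100) :=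
  dt_weilPositivityOn hE hO

/-- The bottom of Weil's form on `[-83/100, 83/100]` is non-negative, from the two blocks. [folklore] -/
theorem weilGroundEnergy_83_nonneg_of_blocks (hE : 0 ≤ weilEvenGroundEnergy (83 / 100))
    (hO : 0 ≤ weilOddGroundEnergy (83 / 100)) : 0 ≤ weilGroundEnergy (83 / 100) := by
  rw [weilGroundEnergy_eq_min_even_odd]
  exact le_min hE hO

/-- Weil positivity on every window `a ≤ 83/100` (in particular on the closed three-prime window `(log 5)/2`), from the two
blocks at `83/100`. [folklore] -/
theorem weilPositivityOn_of_le_83_of_blocks (hE : 0 ≤ weilEvenGroundEnergy (83 / 100))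
    (hO : 0 ≤ weilOddGroundEnergy (83 / 100)) {a : ℝ} (ha : a ≤ 83 / 100) : WeilPositivityOn a :=
  (weilPositivityOn_83_of_blocks hE hO).mono ha

/-- In particular the two blocks at `83/100` also give Weil positivity on the closed three-prime window. [folklore] -/
theorem weilPositivityOn_log5half_of_blocks83 (hE : 0 ≤ weilEvenGroundEnergy (83 / 100))
    (hO : 0 ≤ weilOddGroundEnergy (83 / 100)) : WeilPositivityOn (Real.log 5 / 2) :=
  weilPositivityOn_of_le_83_of_blocks hE hO log5half_lt_83.le

end Summit.RiemannHypothesis.RiemannHypothesis.Theorems.EvenWinsBeyondArch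

end
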